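import Mathlib
import HarnessLib
import Summits.NavierStokesRegularity.NavierStokesRegularity.Theorems.PoloidalWindowDoorPoloidalWindowRigidityZShockNoetherLaws

/-!
# Crux K2 `PoloidalWindowRigidity` (stmt-NavierStokesRegularity-19708), line `z_shock` — the CONSERVED Noether energy of the autonomous
# height-evolution is COERCIVE and FLUX-DOMINATED in the centred gauge (R3 entrance: an exact positive balance law, no exponential factor)

`--supports stmt-NavierStokesRegularity-19708 --as helper` (leafhand-ns-poloidalwindowdoor-3 g7, cell decomp-ns, 2026-08-31).  Class-free,
def-free, Mathlib + `…ZShockNoetherLaws` only.  **No stub and no summit is closed by this file; Navier–Stokes regularity is NOT proved here (rung 0).**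

CONTEXT.  `…ZShockNoetherLaws.energyLaw_of_slope` (p825599) is the exact z-translation Noether law of the autonomous column,
`∂₂[Ψ(w) − ½|vₕ|²] + ∂₀[Γ(w)v₀] + ∂₁[Γ(w)v₁] = 0` (`Γ' = G` the slope function, `Ψ' = Γ`; `G = −c² < 0` on the hyperbolic window), valid
for EVERY choice of the antiderivatives `Γ, Ψ` («the gauge is the user's»).  That file and the census (3-g4 … 3-g6) record that the
positive-definite WAVE energy `½w_z² + ½c²|∇ₕw|²` is NOT conserved on the thick column (signed cubic source), and the R3 entrance
`…ZShockConeEnergy.coneEnergy_of_class_autonomy` therefore carries a Grönwall factor `e^{K(t−t₁)}`.  THIS FILE records the complementary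
elementary fact: in the CENTRED GAUGE `Γ(w⋆) = 0` (`w⋆` any reference value — shifting `Γ` by a constant shifts `φ` by a function of the
height only and does not change `vₕ = ∇ₕφ`), the CONSERVED Noether density `e = Ψ(w⋆) − Ψ(w) + ½|vₕ|²` is

* COERCIVE: `Ψ` is concave where `G ≤ −cmin² < 0`, so `Ψ(w⋆) − Ψ(w) ≥ ½cmin²(w − w⋆)²` (`concavityGap_of_slope_le`), hence
  `e ≥ ½cmin²(w − w⋆)² + ½|vₕ|² ≥ 0` (`noetherEnergy_coercive`);
* FLUX-DOMINATED: `|Γ(w)| ≤ cmax²|w − w⋆|` where `|G| ≤ cmax²` (`abs_potential_le_of_slope_bound`), so the Noether flux `Γ(w)vₕ` obeys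
  `|Γ(w)|·‖vₕ‖ ≤ (cmax²/cmin)·e` (`noetherFlux_le_energy`).

So on a strictly hyperbolic cone of the autonomous column the exact law of p825599 is a POSITIVE balance law `∂₂e + divₕ(−Γ(w)vₕ) = 0` with
flux speed `≤ cmax²/cmin` and ZERO source — precisely the shape consumed by `…ZShockLocalEnergy(Local).coneEnergy_le_exp_mul` /
`setIntegral_closedBall_le_exp_mul` with `K = 0`: the cone-local Noether energy is NON-INCREASING towards the apex in BOTH height directions
(height reversal, `…ZShockSliceTyping`), with no exponential loss.  The hypotheses below are on the segment `[[w⋆, w]]` only (the value range);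
`Γ, Ψ` are differentiable everywhere (antiderivatives).  Pure one-variable calculus (monotonicity from the sign of a derivative, mean value
inequality, AM–GM); nothing is claimed about rigidity.  presearch: none needed (calculus); the remark «the Legendre energy `pF'(p) − F(p) +
½|∇φ|²` of `L = F(φ_z) − ½|∇φ|²` is positive for convex `F`» is textbook (e.g. [corpus: book:alinhac2009 ch. 6 energy of quasilinear wave
equations]). [folklore]
-/

noncomputable section

namespace Summit.NavierStokesRegularity.NavierStokesRegularity.Theorems.PoloidalWindowDoorPoloidalWindowRigidityZShockNoetherEnergyCoercive

-- the summit and its single sub-problem share the name (CONVENTIONS §1)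
set_option linter.dupNamespace false

open Set Filter Topology Function
open Literature.Analysis Literature.Analysis.FluidPDE
open Summit.NavierStokesRegularity.NavierStokesRegularity.Theorems.PoloidalWindowDoorPoloidalWindowRigidityZShockNoetherLaws

variable {G Γ Ψ : ℝ → ℝ} {wstar w cmin cmax : ℝ}

/-! ### Concavity gap of `Ψ` -/

/-- **Concavity gap.**  If `Γ' = G`, `Ψ' = Γ` everywhere, `Γ(w⋆) = 0`, and `G ≤ −cmin²` on the segment `[[w⋆, w]]`, then
`Ψ(w⋆) − Ψ(w) ≥ ½cmin²(w − w⋆)²` (the auxiliary `D(r) = Ψ(w⋆) − Ψ(r) − ½cmin²(r − w⋆)²` has `D(w⋆) = D'(w⋆) = 0` and `D'' = −G − cmin² ≥ 0` on the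
segment). [folklore] -/
theorem concavityGap_of_slope_le (hΓ : ∀ r, HasDerivAt Γ (G r) r) (hΨ : ∀ r, HasDerivAt Ψ (Γ r) r) (hΓ0 : Γ wstar = 0)
    (hG : ∀ r ∈ uIcc wstar w, G r ≤ -cmin ^ 2) :
    (1 / 2) * cmin ^ 2 * (w - wstar) ^ 2 ≤ Ψ wstar - Ψ w := by
  -- the auxiliary function and its two derivatives
  set D : ℝ → ℝ := fun r => Ψ wstar - Ψ r - (1 / 2) * cmin ^ 2 * (r - wstar) ^ 2 with hD_def
  set D' : ℝ → ℝ := fun r => -Γ r - cmin ^ 2 * (r - wstar) with hD'_def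
  have hDd : ∀ r, HasDerivAt D (D' r) r := by
    intro r
    have h0 : HasDerivAt (fun r => r - wstar) 1 r := (hasDerivAt_id r).sub_const wstar
    have h1 : HasDerivAt (fun r => (r - wstar) ^ 2) (((2 : ℕ) : ℝ) * (r - wstar) ^ (2 - 1) * 1) r := h0.pow 2
    have h2 : HasDerivAt (fun r => Ψ wstar - Ψ r - (1 / 2) * cmin ^ 2 * (r - wstar) ^ 2)
        (0 - Γ r - (1 / 2) * cmin ^ 2 * (((2 : ℕ) : ℝ) * (r - wstar) ^ (2 - 1) * 1)) r :=
      ((hasDerivAt_const r (Ψ wstar)).sub (hΨ r)).sub (h1.const_mul ((1 / 2) * cmin ^ 2))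
    exact h2.congr_deriv (by simp only [hD'_def]; push_cast; ring)
  have hD'd : ∀ r, HasDerivAt D' (-G r - cmin ^ 2) r := by
    intro r
    have h2 : HasDerivAt (fun r => -Γ r - cmin ^ 2 * (r - wstar)) (-G r - cmin ^ 2 * 1) r :=
      (hΓ r).neg.sub (((hasDerivAt_id r).sub_const wstar).const_mul (cmin ^ 2))
    exact h2.congr_deriv (by ring)
  have hD0 : D wstar = 0 := by simp [hD_def]
  have hD'0 : D' wstar = 0 := by simp [hD'_def, hΓ0]
  have hDc : Continuous D := continuous_iff_continuousAt.2 fun r => (hDd r).continuousAt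
  have hD'c : Continuous D' := continuous_iff_continuousAt.2 fun r => (hD'd r).continuousAt
  -- `D w ≥ 0`, by cases on the order of `w⋆` and `w`
  have key : 0 ≤ D w := by
    rcases le_total wstar w with hle | hle
    · -- `w⋆ ≤ w`: `D'` is monotone on `[w⋆, w]`, hence `≥ 0` there, hence `D` is monotone there
      have hseg : uIcc wstar w = Icc wstar w := uIcc_of_le hle
      have hD'mono : MonotoneOn D' (Icc wstar w) := by
        refine monotoneOn_of_deriv_nonneg (convex_Icc _ _) hD'c.continuousOn (fun r _ => (hD'd r).differentiableAt.differentiableWithinAt)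
          fun r hr => ?_
        rw [(hD'd r).deriv]
        have hr' : r ∈ uIcc wstar w := by rw [hseg]; exact interior_subset hr
        linarith [hG r hr']
      have hD'nn : ∀ r ∈ interior (Icc wstar w), 0 ≤ deriv D r := by
        intro r hr
        rw [(hDd r).deriv]
        have hr' : r ∈ Icc wstar w := interior_subset hr
        have := hD'mono (left_mem_Icc.2 hle) hr' hr'.1
        rwa [hD'0] at this
      have hDmono : MonotoneOn D (Icc wstar w) :=
        monotoneOn_of_deriv_nonneg (convex_Icc _ _) hDc.continuousOn (fun r _ => (hDd r).differentiableAt.differentiableWithinAt) hD'nn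
      have := hDmono (left_mem_Icc.2 hle) (right_mem_Icc.2 hle) hle
      rwa [hD0] at this
    · -- `w ≤ w⋆`: `D'` is monotone on `[w, w⋆]`, hence `≤ 0` there, hence `D` is antitone there
      have hseg : uIcc wstar w = Icc w wstar := uIcc_of_ge hle
      have hD'mono : MonotoneOn D' (Icc w wstar) := by
        refine monotoneOn_of_deriv_nonneg (convex_Icc _ _) hD'c.continuousOn (fun r _ => (hD'd r).differentiableAt.differentiableWithinAt)
          fun r hr => ?_
        rw [(hD'd r).deriv]
        have hr' : r ∈ uIcc wstar w := by rw [hseg]; exact interior_subset hr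
        linarith [hG r hr']
      have hD'np : ∀ r ∈ interior (Icc w wstar), deriv D r ≤ 0 := by
        intro r hr
        rw [(hDd r).deriv]
        have hr' : r ∈ Icc w wstar := interior_subset hr
        have := hD'mono hr' (right_mem_Icc.2 hle) hr'.2
        rwa [hD'0] at this
      have hDanti : AntitoneOn D (Icc w wstar) :=
        antitoneOn_of_deriv_nonpos (convex_Icc _ _) hDc.continuousOn (fun r _ => (hDd r).differentiableAt.differentiableWithinAt) hD'np
      have := hDanti (left_mem_Icc.2 hle) (right_mem_Icc.2 hle) hle
      rwa [hD0] at this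
  have hDw : D w = Ψ wstar - Ψ w - (1 / 2) * cmin ^ 2 * (w - wstar) ^ 2 := rfl
  linarith

/-! ### The potential `Γ` is Lipschitz on the segment -/

/-- **`|Γ(w)| ≤ cmax²·|w − w⋆|`** if `Γ' = G` everywhere, `Γ(w⋆) = 0` and `|G| ≤ cmax²` on `[[w⋆, w]]` (mean value inequality). [folklore] -/
theorem abs_potential_le_of_slope_bound (hΓ : ∀ r, HasDerivAt Γ (G r) r) (hΓ0 : Γ wstar = 0)
    (hGb : ∀ r ∈ uIcc wstar w, |G r| ≤ cmax ^ 2) :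
    |Γ w| ≤ cmax ^ 2 * |w - wstar| := by
  have h := Convex.norm_image_sub_le_of_norm_hasDerivWithin_le (s := uIcc wstar w) (f := Γ) (f' := G) (C := cmax ^ 2)
    (fun r _ => (hΓ r).hasDerivWithinAt) (fun r hr => by rw [Real.norm_eq_abs]; exact hGb r hr) (convex_uIcc _ _)
    left_mem_uIcc right_mem_uIcc
  rw [hΓ0, sub_zero, Real.norm_eq_abs, Real.norm_eq_abs] at h
  exact h

/-! ### Coercivity and flux domination of the Noether energy -/

/-- **The centred Noether energy is coercive**: under the hypotheses of `concavityGap_of_slope_le`, for every `V ≥ 0` (read `V = ½|vₕ|²`),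
`½cmin²(w − w⋆)² + V ≤ Ψ(w⋆) − Ψ(w) + V`; in particular the energy density is nonnegative. [folklore] -/
theorem noetherEnergy_coercive (hΓ : ∀ r, HasDerivAt Γ (G r) r) (hΨ : ∀ r, HasDerivAt Ψ (Γ r) r) (hΓ0 : Γ wstar = 0)
    (hG : ∀ r ∈ uIcc wstar w, G r ≤ -cmin ^ 2) {V : ℝ} (hV : 0 ≤ V) :
    (1 / 2) * cmin ^ 2 * (w - wstar) ^ 2 + V ≤ Ψ wstar - Ψ w + V ∧ 0 ≤ Ψ wstar - Ψ w + V := by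
  have h := concavityGap_of_slope_le hΓ hΨ hΓ0 hG
  refine ⟨by linarith, ?_⟩
  have : 0 ≤ (1 / 2) * cmin ^ 2 * (w - wstar) ^ 2 := by positivity
  linarith

/-- **The Noether flux is dominated by the energy**: if moreover `0 < cmin` and `|G| ≤ cmax²` on `[[w⋆, w]]`, then for every `q ≥ 0` (read
`q = ‖vₕ‖`), `|Γ(w)|·q ≤ (cmax²/cmin)·(Ψ(w⋆) − Ψ(w) + ½q²)` (mean value inequality + AM–GM + the concavity gap). [folklore] -/
theorem noetherFlux_le_energy (hΓ : ∀ r, HasDerivAt Γ (G r) r) (hΨ : ∀ r, HasDerivAt Ψ (Γ r) r) (hΓ0 : Γ wstar = 0)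
    (hcmin : 0 < cmin) (hG : ∀ r ∈ uIcc wstar w, G r ≤ -cmin ^ 2) (hGb : ∀ r ∈ uIcc wstar w, |G r| ≤ cmax ^ 2) {q : ℝ} (hq : 0 ≤ q) :
    |Γ w| * q ≤ cmax ^ 2 / cmin * (Ψ wstar - Ψ w + (1 / 2) * q ^ 2) := by
  have hgap := concavityGap_of_slope_le hΓ hΨ hΓ0 hG
  have hlip := abs_potential_le_of_slope_bound hΓ hΓ0 hGb
  have hcmax : 0 ≤ cmax ^ 2 := sq_nonneg _
  -- AM–GM: `|w − w⋆| q ≤ (cmin (w − w⋆)² + q²/cmin)/2`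
  have hamgm : |w - wstar| * q ≤ (1 / 2) * (cmin * (w - wstar) ^ 2 + q ^ 2 / cmin) := by
    have h1 : 0 ≤ (cmin * |w - wstar| - q) ^ 2 / cmin := div_nonneg (sq_nonneg _) hcmin.le
    have h2 : (cmin * |w - wstar| - q) ^ 2 / cmin = cmin * (w - wstar) ^ 2 + q ^ 2 / cmin - 2 * (|w - wstar| * q) := by
      field_simp
      rw [← sq_abs (w - wstar)]
      ring
    linarith
  have halg : cmax ^ 2 * ((1 / 2) * (cmin * (w - wstar) ^ 2 + q ^ 2 / cmin)) =
      cmax ^ 2 / cmin * ((1 / 2) * cmin ^ 2 * (w - wstar) ^ 2 + (1 / 2) * q ^ 2) := by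
    have hc : cmin ≠ 0 := hcmin.ne'
    have h1 : q ^ 2 / cmin = q ^ 2 * cmin⁻¹ := div_eq_mul_inv _ _
    have h2 : cmax ^ 2 / cmin = cmax ^ 2 * cmin⁻¹ := div_eq_mul_inv _ _
    have h3 : cmin * cmin⁻¹ = 1 := mul_inv_cancel₀ hc
    rw [h1, h2]
    linear_combination (-(1 / 2) * cmax ^ 2 * cmin * (w - wstar) ^ 2) * h3
  calc |Γ w| * q ≤ cmax ^ 2 * |w - wstar| * q := mul_le_mul_of_nonneg_right hlip hq
    _ = cmax ^ 2 * (|w - wstar| * q) := by ring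
    _ ≤ cmax ^ 2 * ((1 / 2) * (cmin * (w - wstar) ^ 2 + q ^ 2 / cmin)) := mul_le_mul_of_nonneg_left hamgm hcmax
    _ = cmax ^ 2 / cmin * ((1 / 2) * cmin ^ 2 * (w - wstar) ^ 2 + (1 / 2) * q ^ 2) := halg
    _ ≤ cmax ^ 2 / cmin * (Ψ wstar - Ψ w + (1 / 2) * q ^ 2) :=
      mul_le_mul_of_nonneg_left (by linarith) (div_nonneg hcmax hcmin.le)

/-! ### The energy law of `…ZShockNoetherLaws` as a balance law for the centred density -/

/-- **The Noether energy law in balance form for the centred density.**  Under the hypotheses of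
`…ZShockNoetherLaws.energyLaw_of_slope` (slice `f : ℝ³ → ℝ³` differentiable at `x`, slope law at `x`, `div f (x) = 0`, `Γ' = G` and `Ψ' = Γ`
at the value `f₂(x)`), the centred density `e = Ψ(w⋆) − Ψ(f₂) + ½(f₀² + f₁²)` satisfies
`∂₂ e = ∂₀[Γ(f₂) f₀] + ∂₁[Γ(f₂) f₁]` at `x`, i.e. `∂₂e + ∂₀[−Γ(f₂)f₀] + ∂₁[−Γ(f₂)f₁] = 0`: a balance law with ZERO source whose density is
nonnegative (`noetherEnergy_coercive`) and whose flux is dominated by `(cmax²/cmin)·e` (`noetherFlux_le_energy`) on a strictly hyperbolic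
value range in the centred gauge. [folklore] -/
theorem noetherBalance_of_slope {f : EuclideanSpace ℝ (Fin 3) → EuclideanSpace ℝ (Fin 3)} {x : EuclideanSpace ℝ (Fin 3)}
    (hf : DifferentiableAt ℝ f x) (hΓ : HasDerivAt Γ (G (f x 2)) (f x 2)) (hΨ : HasDerivAt Ψ (Γ (f x 2)) (f x 2))
    (hslope : ∀ b : Fin 3, b ≠ 2 →
      fderiv ℝ f x (EuclideanSpace.single 2 1) b = G (f x 2) * fderiv ℝ f x (EuclideanSpace.single b 1) 2)
    (hdiv : VectorCalculus.divergence f x = 0) (wstar : ℝ) :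
    fderiv ℝ (fun y => Ψ wstar - Ψ (f y 2) + (1 / 2) * (f y 0 ^ 2 + f y 1 ^ 2)) x (EuclideanSpace.single 2 1) =
      fderiv ℝ (fun y => Γ (f y 2) * f y 0) x (EuclideanSpace.single 0 1) +
        fderiv ℝ (fun y => Γ (f y 2) * f y 1) x (EuclideanSpace.single 1 1) := by
  have hlaw := energyLaw_of_slope hf hΓ hΨ hslope hdiv
  -- the old density is differentiable at `x`, and the centred one is `Ψ(w⋆) −` it
  have hc := hasFDerivAt_coord hf
  have hold : DifferentiableAt ℝ (fun y => Ψ (f y 2) - (1 / 2) * (f y 0 ^ 2 + f y 1 ^ 2)) x :=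
    ((hΨ.comp_hasFDerivAt x (hc 2)).sub ((((hc 0).pow 2).add ((hc 1).pow 2)).const_mul (1 / 2 : ℝ))).differentiableAt
  have hfun : (fun y => Ψ wstar - Ψ (f y 2) + (1 / 2) * (f y 0 ^ 2 + f y 1 ^ 2)) =
      fun y => Ψ wstar - (Ψ (f y 2) - (1 / 2) * (f y 0 ^ 2 + f y 1 ^ 2)) := by
    funext y; ring
  rw [hfun, fderiv_const_sub, neg_apply]
  linarith

end Summit.NavierStokesRegularity.NavierStokesRegularity.Theorems.PoloidalWindowDoorPoloidalWindowRigidityZShockNoetherEnergyCoercive
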